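import Literature.NumberTheory.PAdicHodge.BmaxPlusToBdRPeriods
import Literature.NumberTheory.PAdicHodge.BmaxPlusTDivisibilityAllPrimes
import Literature.NumberTheory.PAdicHodge.BdRPeriodRingData
import Literature.NumberTheory.PAdicHodge.BdRPlusRamifiedLogEvalTower
import Literature.NumberTheory.PAdicHodge.BmaxPlusTransportedHodgePairHne
import HarnessLib

/-!
# The UNIT-ROOT FRAME in `A_max`: eigen-relations `φx = πx`, `φΛ = πΛ` from the Honda relation `(φ − α)(φ − π) = 0`, and the unit-root
# period `u` (`φu = αu`) as a `ψ = χρ⁻¹`-period (height-ONE = ordinary frame for Kato's explicit reciprocity law)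

Topic `Literature/NumberTheory/PAdicHodge`; namespace `Literature.NumberTheory.PAdicHodge`. THEOREMS ONLY (no definition, no named fact, no instance,
no `sorry`). Pure period-ring algebra on top of the tree's `A_max = BmaxPlus F p` (Colmez) toolkit: `(A_max)^{φ=1} = ℤ_p`
(`frobBmaxPlus_eq_self_iff`), Fontaine's lemma `(A_max)^{φ=p} ∩ ker θ ⊆ ℚ_p·t` (`fontaineKernel'`), `(A_max)^{φ=p} ⊆ ℚ_p ⊗ log[1 + 𝔪♭]`
(`isTeichLog_pow_mul_bmaxPlusToBdR`), Fontaine's regularity `B_dR(F)^{Γ_F} = F` (`exists_smul_eq_fracBdR`) and the honest comparison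
`bmaxPlusToBdR : A_max → B_dR⁺`.

SETTING (the ordinary = height-one situation of an elliptic curve with good ORDINARY reduction, abstracted). `α ∈ ℤ_pˣ` and `π ∈ ℤ_p` with
`απ = p` (the unit root and the non-unit root of `X² − aX + p`, `a = α + π`); `u ∈ A_maxˣ` with `φu = αu` (the unramified period of the unit-root
character, `FrobeniusUnitRootPeriod`); `x ∈ A_max` with the Dieudonné–Honda relation `φ²x − aφx + px = 0` on which `Γ_F` acts through a character
`ρ` (`σx = ρ(σ)x` — the period `LT v₀` of a generator `v₀` of the rank-ONE formal Tate module, `BmaxPlusTransportedPeriodHom`); a «Hodge pair»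
`H₀ = ι(A)·f(x) + ι(B)·f(φx) ∈ Fil¹ B_dR⁺`, `H₀ ≠ 0` (`A, B ∈ F`, `f = bmaxPlusToBdR`; the transported Hodge line evaluated at `v₀`); and a «Kummer
integral» `Λ ∈ A_max` with the same Honda relation and `σΛ = Λ + k(σ)·x` (the transported period of the division tower of a formal point,
`logSum_transport_kummerCocycleO`).

* §1 `exists_eq_zp_mul_unitRoot_of_frobBmaxPlus_eq` — **the `α`-eigenline is `ℤ_p·u`**: `φz = αz ⟹ z = ι(c)·u`.
* §2 ★★ `frobBmaxPlus_eq_pi_mul_of_honda_of_hodgePair` — **`φx = πx`**: `z = φx − πx` is an `α`-eigenvector, so `z = c′u`; if `c′ ≠ 0` then `u` is a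
  `ρ`-period, `f(x) ∈ F·f(u)` (Fontaine's regularity), and `H₀ ∈ (F·f(u)) ∩ Fil¹ = 0` — contradiction. ★ `thetaBmaxPlus_eq_zero_of_honda_of_hodgePair` —
  then `H₀ = ι(A + Bπ)·f(x)`, so `θ(x) = 0`.
* §3 ★★ `exists_pow_mul_unitRoot_mul_eq_tBmax` — **`p^k·u·x = ι(c)·t`, `c ≠ 0`** (Fontaine's lemma for `ux ∈ (A_max)^{φ=p} ∩ ker θ`), and
  ★★ `galBmaxPlus_unitRoot_mul` — **`u` is a `χρ⁻¹`-period: `σ(u)·ρ(σ) = χ(σ)·u`**.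
* §4 ★★ `frobBmaxPlus_kummer_eq_pi_mul` — **`φΛ = πΛ`** as soon as `ρ ≠ χ` (`φΛ − πΛ = c″u` is `Γ_F`-invariant).
* Sequel `UnitRootFrameKTwo`: Kato's (K₂) in this frame (`t·Λ/x ∈ ℚ_p·(A_max)^{φ=p}` read in `B_dR⁺`) and the discharge of `ρ ≠ χ`.

BSD context: line `kato_lever` of crux K★ `stmt-BirchSwinnertonDyer-22226`, stub `stub_localFormulaOrdinaryCells` — the (G)-ORDINARY starred cells, memo
`Summits/BirchSwinnertonDyer/BirchSwinnertonDyer/Cruxes/StarredOptimalManinUnitFiveSeven/Lines/kato-lever-seam-rec-at-cells.md` §17 «unit-root frame»: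
with `Pη(a) = ē(a)·u`, `b_η = 0`, the socket `TatePairingPointOfKTwoBasis` asks (K₂) exactly in the shape of §5 (`X = x̃(v₁)`, `X·H₀ = e₀·t·H_P` by the
Legendre relation). Infrastructure only: BSD / K★ are NOT proved by any of this; nothing about elliptic curves is proved here.

## References
* [FontaineAsterisque223III] J.-M. Fontaine, *Le corps des périodes p-adiques*, Astérisque 223 (1994), Exp. II §1.5, Exp. III Th. 5.3.7.
* [Colmez1998Annals] P. Colmez, *Théorie d'Iwasawa des représentations de de Rham d'un corps local*, Ann. of Math. 148 (1998), §III.2–III.3.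
* [Kato1993LNM1553] K. Kato, LNM 1553 (1993), Ch. II Thm. 1.4.1, Lemma 1.4.3.
* [BlochKato1990] S. Bloch, K. Kato (1990), Example 3.11.
* [Tate1967] J. Tate, *p-divisible groups* (1967), §4 (the unit-root / étale quotient at ordinary reduction).
-/

noncomputable section

open WittVector Field ValuativeRel

namespace Literature.NumberTheory.PAdicHodge

open Literature.NumberTheory.GaloisRepresentations
open Literature.NumberTheory.GaloisRepresentations.IsNonarchimedeanLocalField
open GaloisContinuity

variable {F : Type} [Field F] [ValuativeRel F] [TopologicalSpace F] [IsNonarchimedeanLocalField F]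
  [CharZero F] {p : ℕ} [Fact p.Prime] [Fact (¬ IsUnit (p : integerC F))]
  [IsAdicComplete (Ideal.span {(p : integerC F)}) (integerC F)]

/-! ## §0 Scalars `ι : ℤ_p → A_max` (non-zero scalars are non-zero-divisors: `eq_zero_of_zpToAinf_mul_eq_zero`, tree) -/

omit [CharZero F] [IsAdicComplete (Ideal.span {(p : integerC F)}) (integerC F)] in
/-- `ι(α)` is a unit of `A_max` for `α ∈ ℤ_pˣ`. [cite: Colmez1998Annals, §III.2] -/
theorem isUnit_ainfToBmaxPlus_zpToAinf {α : ℤ_[p]} (hα : IsUnit α) : IsUnit (ainfToBmaxPlus F p (zpToAinf α)) :=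
  (hα.map zpToAinf).map (ainfToBmaxPlus F p)

/-! ## §1 The `α`-eigenline of `φ` is `ℤ_p · u` -/

/-- ★ **The `α`-eigenline is `ℤ_p·u`.** If `u ∈ A_maxˣ` has `φu = ι(α)·u` (`α ∈ ℤ_pˣ`) then every `z` with `φz = ι(α)·z` is `z = ι(c)·u` for a
(unique) `c ∈ ℤ_p`: `z·u⁻¹` is Frobenius-fixed and `(A_max)^{φ=1} = ℤ_p`. [cite: Colmez1998Annals, §III.2] [cite: FontaineAsterisque223III, Exp. III §5.3] -/
theorem exists_eq_zp_mul_unitRoot_of_frobBmaxPlus_eq (hF : Function.Surjective (fontaineTheta (integerC F) p))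
    {α : ℤ_[p]} {u : BmaxPlus F p} (hu : IsUnit u)
    (hφu : frobBmaxPlus F p u = ainfToBmaxPlus F p (zpToAinf α) * u) {z : BmaxPlus F p}
    (hz : frobBmaxPlus F p z = ainfToBmaxPlus F p (zpToAinf α) * z) :
    ∃ c : ℤ_[p], z = ainfToBmaxPlus F p (zpToAinf c) * u := by
  have h1 : u * ↑hu.unit⁻¹ = 1 := hu.mul_val_inv
  have h2 : frobBmaxPlus F p u * frobBmaxPlus F p ↑hu.unit⁻¹ = 1 := by rw [← map_mul, h1, map_one]
  have hw : frobBmaxPlus F p (z * ↑hu.unit⁻¹) = z * ↑hu.unit⁻¹ := by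
    rw [map_mul, hz]
    linear_combination (-(z * ↑hu.unit⁻¹ * frobBmaxPlus F p ↑hu.unit⁻¹)) * hφu
      + (-(ainfToBmaxPlus F p (zpToAinf α) * z * frobBmaxPlus F p ↑hu.unit⁻¹)) * h1 + (z * ↑hu.unit⁻¹) * h2
  obtain ⟨c, hc⟩ := (frobBmaxPlus_eq_self_iff hF _).1 hw
  refine ⟨c, ?_⟩
  calc z = z * ↑hu.unit⁻¹ * u := by rw [mul_assoc, hu.val_inv_mul, mul_one]
    _ = ainfToBmaxPlus F p (zpToAinf c) * u := by rw [hc]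

/-! ## §2 The eigen-relation `φx = πx` from the Honda relation and a nonzero Hodge pair in `Fil¹` -/

omit [CharZero F] [IsAdicComplete (Ideal.span {(p : integerC F)}) (integerC F)] in
set_option maxHeartbeats 1600000 in
/-- `φ(φx − πx) = α·(φx − πx)` when `φ²x − (α + π)φx + px = 0` and `απ = p`. [cite: Honda1970, Thm. 2] -/
theorem frobBmaxPlus_sub_pi_mul_of_honda {α π : ℤ_[p]} (hαπ : α * π = p) {x : BmaxPlus F p}
    (hx : frobBmaxPlus F p (frobBmaxPlus F p x) - ainfToBmaxPlus F p (zpToAinf (α + π)) * frobBmaxPlus F p x + (p : BmaxPlus F p) * x = 0) :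
    frobBmaxPlus F p (frobBmaxPlus F p x - ainfToBmaxPlus F p (zpToAinf π) * x) =
      ainfToBmaxPlus F p (zpToAinf α) * (frobBmaxPlus F p x - ainfToBmaxPlus F p (zpToAinf π) * x) := by
  obtain ⟨a, ha⟩ : ∃ a, a = ainfToBmaxPlus F p (zpToAinf α) := ⟨_, rfl⟩
  obtain ⟨b, hb⟩ : ∃ b, b = ainfToBmaxPlus F p (zpToAinf π) := ⟨_, rfl⟩
  have hp' : (p : BmaxPlus F p) = a * b := by
    rw [ha, hb, ← map_mul, ← map_mul, hαπ, map_natCast, map_natCast]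
  have hab : ainfToBmaxPlus F p (zpToAinf (α + π)) = a + b := by rw [map_add, map_add, ha, hb]
  have hφb : frobBmaxPlus F p b = b := by rw [hb, frobBmaxPlus_ainfToBmaxPlus, frobenius_zpToAinf]
  rw [hab, hp'] at hx
  rw [← hb, ← ha, map_sub, map_mul, hφb]
  linear_combination hx

set_option maxHeartbeats 1600000 in
/-- The `Γ_F`-action on a Honda eigen-candidate: if `σx = ρ(σ)·x` then `σ(φx − πx) = ρ(σ)·(φx − πx)` (`φ` commutes with `Γ_F`).
[cite: BergerLaurent2002, §1.2] [cite: Colmez1998Annals, §III.2] -/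
theorem galBmaxPlus_frob_sub_pi_mul {π : ℤ_[p]} {x : BmaxPlus F p} (ρ : absoluteGaloisGroup F → ℤ_[p])
    (hρ : ∀ σ, galBmaxPlus σ x = ainfToBmaxPlus F p (zpToAinf (ρ σ)) * x) (σ : absoluteGaloisGroup F) :
    galBmaxPlus σ (frobBmaxPlus F p x - ainfToBmaxPlus F p (zpToAinf π) * x) =
      ainfToBmaxPlus F p (zpToAinf (ρ σ)) * (frobBmaxPlus F p x - ainfToBmaxPlus F p (zpToAinf π) * x) := by
  obtain ⟨b, hb⟩ : ∃ b, b = ainfToBmaxPlus F p (zpToAinf π) := ⟨_, rfl⟩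
  obtain ⟨r, hr⟩ : ∃ r, r = ainfToBmaxPlus F p (zpToAinf (ρ σ)) := ⟨_, rfl⟩
  have hσb : galBmaxPlus σ b = b := by rw [hb, galBmaxPlus_ainfToBmaxPlus, galAinf_zpToAinf]
  have hφr : frobBmaxPlus F p r = r := by rw [hr, frobBmaxPlus_ainfToBmaxPlus, frobenius_zpToAinf]
  have h1 : galBmaxPlus σ (frobBmaxPlus F p x) = r * frobBmaxPlus F p x := by
    rw [galBmaxPlus_frobBmaxPlus, hρ, map_mul, ← hr, hφr]
  rw [← hb, ← hr, map_sub, map_mul, h1, hσb, hρ, ← hr]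
  ring

set_option maxHeartbeats 3200000 in
set_option synthInstance.maxHeartbeats 400000 in
/-- ★★ **`φx = πx` for the rank-one period.** Data: `απ = p`, `u ∈ A_maxˣ` with `φu = αu`, the Honda relation `φ²x − (α+π)φx + px = 0`,
`σx = ρ(σ)x` for all `σ ∈ Γ_F`, and `A, B ∈ F` with `H₀ = ι(A)f(x) + ι(B)f(φx) ∈ ker θ`, `H₀ ≠ 0` (`f = bmaxPlusToBdR`). Then **`φx = ι(π)·x`.**
Proof: `φx − πx = c′u` (§1); if `c′ ≠ 0`, `u` is a `ρ`-period, so `f(x) = λ·f(u)` with `λ ∈ F` (Fontaine's regularity `B_dR^{Γ_F} = F`), hence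
`H₀ = ι(Aλ + B(πλ + c′))·f(u)` with `θ(H₀) = 0`, `θ(f u) ≠ 0` — so the scalar vanishes and `H₀ = 0`.
[cite: FontaineAsterisque223III, Exp. III §1.4–1.5] [cite: Colmez1998Annals, §III.2] [cite: Tate1967, §4] -/
theorem frobBmaxPlus_eq_pi_mul_of_honda_of_hodgePair (hF : Function.Surjective (fontaineTheta (integerC F) p)) (hpv : valuation F p < 1)
    {α π : ℤ_[p]} (hαπ : α * π = p) {u : BmaxPlus F p} (hu : IsUnit u)
    (hφu : frobBmaxPlus F p u = ainfToBmaxPlus F p (zpToAinf α) * u) {x : BmaxPlus F p}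
    (hx : frobBmaxPlus F p (frobBmaxPlus F p x) - ainfToBmaxPlus F p (zpToAinf (α + π)) * frobBmaxPlus F p x + (p : BmaxPlus F p) * x = 0)
    (ρ : absoluteGaloisGroup F → ℤ_[p]) (hρ : ∀ σ, galBmaxPlus σ x = ainfToBmaxPlus F p (zpToAinf (ρ σ)) * x)
    {A B : F} (hfil : thetaBdR (embBdRHom hpv hF A * bmaxPlusToBdR F p x + embBdRHom hpv hF B * bmaxPlusToBdR F p (frobBmaxPlus F p x)) = 0)
    (hne : embBdRHom hpv hF A * bmaxPlusToBdR F p x + embBdRHom hpv hF B * bmaxPlusToBdR F p (frobBmaxPlus F p x) ≠ 0) :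
    frobBmaxPlus F p x = ainfToBmaxPlus F p (zpToAinf π) * x := by
  haveI : IsDomain (BDeRhamPlus (integerC F) p) := isDomain_bDeRhamPlus hF
  obtain ⟨c', hc'⟩ := exists_eq_zp_mul_unitRoot_of_frobBmaxPlus_eq hF hu hφu (frobBmaxPlus_sub_pi_mul_of_honda hαπ hx)
  by_cases hc0 : c' = 0
  · rw [hc0, map_zero, map_zero, zero_mul, sub_eq_zero] at hc'; exact hc'
  exfalso
  obtain ⟨b, hb⟩ : ∃ b, b = ainfToBmaxPlus F p (zpToAinf π) := ⟨_, rfl⟩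
  obtain ⟨r, hr⟩ : ∃ r, r = ainfToBmaxPlus F p (zpToAinf c') := ⟨_, rfl⟩
  rw [← hb, ← hr] at hc'
  -- `u` is a `ρ`-period
  have hρu : ∀ σ, galBmaxPlus σ u = ainfToBmaxPlus F p (zpToAinf (ρ σ)) * u := by
    intro σ
    have h := galBmaxPlus_frob_sub_pi_mul (π := π) ρ hρ σ
    rw [← hb, hc', map_mul, hr, galBmaxPlus_ainfToBmaxPlus, galAinf_zpToAinf, ← hr] at h
    rw [← sub_eq_zero]
    refine eq_zero_of_zpToAinf_mul_eq_zero hF hc0 ?_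
    rw [← hr]
    linear_combination h
  -- `f(x) = λ·f(u)` with `λ ∈ F`
  obtain ⟨fu, hfu⟩ : ∃ y, y = bmaxPlusToBdR F p u := ⟨_, rfl⟩
  obtain ⟨fx, hfx⟩ : ∃ y, y = bmaxPlusToBdR F p x := ⟨_, rfl⟩
  have hfu_unit : IsUnit fu := hfu ▸ hu.map _
  have hfu0 : algebraMap (BDeRhamPlus (integerC F) p) (FracBdR F p) fu ≠ 0 :=
    fun h => hfu_unit.ne_zero (algebraMap_fracBdR_injective (by rw [h, map_zero]))
  obtain ⟨lam, hlam⟩ := exists_smul_eq_fracBdR hpv hF (algebraMap _ (FracBdR F p) fx) (algebraMap _ (FracBdR F p) fu) hfu0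
    (fun σ => by
      obtain ⟨q, hq⟩ : ∃ q, q = bmaxPlusToBdR F p (ainfToBmaxPlus F p (zpToAinf (ρ σ))) := ⟨_, rfl⟩
      have e1 : galBdRPlus σ fx = q * fx := by rw [hfx, galBdRPlus_bmaxPlusToBdR, hρ σ, map_mul, ← hq]
      have e2 : galBdRPlus σ fu = q * fu := by rw [hfu, galBdRPlus_bmaxPlusToBdR, hρu σ, map_mul, ← hq]
      rw [smul_algebraMap_fracBdR, smul_algebraMap_fracBdR, e1, e2, map_mul, map_mul]
      ring)
  letI := fracAlgebra (p := p) hpv hF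
  rw [Algebra.smul_def, algebraMap_fracAlgebra, ← map_mul] at hlam
  have hlam' : fx = embBdRHom hpv hF lam * fu := algebraMap_fracBdR_injective hlam
  -- the Hodge pair is an `F`-multiple of `f(u)`
  have hπ' : embBdRHom hpv hF (LocalField.padicRingHom F p hpv (π : ℚ_[p])) = bmaxPlusToBdR F p b := by
    rw [AinfRam.embBdRHom_padicRingHom' (hp := hpv) hF, hb, bmaxPlusToBdR_ainfToBmaxPlus_zpToAinf]
  have hc'' : embBdRHom hpv hF (LocalField.padicRingHom F p hpv (c' : ℚ_[p])) = bmaxPlusToBdR F p r := by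
    rw [AinfRam.embBdRHom_padicRingHom' (hp := hpv) hF, hr, bmaxPlusToBdR_ainfToBmaxPlus_zpToAinf]
  have hφx : bmaxPlusToBdR F p (frobBmaxPlus F p x) = bmaxPlusToBdR F p b * fx + bmaxPlusToBdR F p r * fu := by
    rw [eq_add_of_sub_eq' hc', map_add, map_mul, map_mul, ← hfx, ← hfu]
  obtain ⟨γ, hγ⟩ : ∃ γ : F,
      γ = A * lam + B * (LocalField.padicRingHom F p hpv (π : ℚ_[p]) * lam + LocalField.padicRingHom F p hpv (c' : ℚ_[p])) := ⟨_, rfl⟩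
  have hH : embBdRHom hpv hF A * bmaxPlusToBdR F p x + embBdRHom hpv hF B * bmaxPlusToBdR F p (frobBmaxPlus F p x) =
      embBdRHom hpv hF γ * fu := by
    rw [hγ, map_add, map_mul, map_mul, map_add, map_mul, hπ', hc'', hφx, ← hfx, hlam']
    ring
  have hθγ : γ = 0 := by
    rw [hH, map_mul, thetaBdR_embBdRHom, mul_eq_zero, map_eq_zero_iff _ (algebraMap F (CompletedAlgClosure F)).injective] at hfil
    exact hfil.resolve_right ((isUnit_iff_thetaBdR_ne_zero hF _).1 hfu_unit)
  exact hne (by rw [hH, hθγ, map_zero, zero_mul])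

set_option maxHeartbeats 3200000 in
set_option synthInstance.maxHeartbeats 400000 in
/-- ★ **`θ(x) = 0`** in the situation of `frobBmaxPlus_eq_pi_mul_of_honda_of_hodgePair`: with `φx = πx` the Hodge pair is
`H₀ = ι(A + Bπ)·f(x)`, nonzero, in `ker θ`; so `A + Bπ ≠ 0` and `θ(f x) = θ_max(x) = 0`.
[cite: FontaineAsterisque223III, Exp. II §1.5] [cite: Colmez1998Annals, §III.2] -/
theorem thetaBmaxPlus_eq_zero_of_honda_of_hodgePair (hF : Function.Surjective (fontaineTheta (integerC F) p)) (hpv : valuation F p < 1)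
    {α π : ℤ_[p]} (hαπ : α * π = p) {u : BmaxPlus F p} (hu : IsUnit u)
    (hφu : frobBmaxPlus F p u = ainfToBmaxPlus F p (zpToAinf α) * u) {x : BmaxPlus F p}
    (hx : frobBmaxPlus F p (frobBmaxPlus F p x) - ainfToBmaxPlus F p (zpToAinf (α + π)) * frobBmaxPlus F p x + (p : BmaxPlus F p) * x = 0)
    (ρ : absoluteGaloisGroup F → ℤ_[p]) (hρ : ∀ σ, galBmaxPlus σ x = ainfToBmaxPlus F p (zpToAinf (ρ σ)) * x)
    {A B : F} (hfil : thetaBdR (embBdRHom hpv hF A * bmaxPlusToBdR F p x + embBdRHom hpv hF B * bmaxPlusToBdR F p (frobBmaxPlus F p x)) = 0)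
    (hne : embBdRHom hpv hF A * bmaxPlusToBdR F p x + embBdRHom hpv hF B * bmaxPlusToBdR F p (frobBmaxPlus F p x) ≠ 0) :
    thetaBmaxPlus F p x = 0 ∧ A + B * LocalField.padicRingHom F p hpv (π : ℚ_[p]) ≠ 0 ∧
      embBdRHom hpv hF A * bmaxPlusToBdR F p x + embBdRHom hpv hF B * bmaxPlusToBdR F p (frobBmaxPlus F p x) =
        embBdRHom hpv hF (A + B * LocalField.padicRingHom F p hpv (π : ℚ_[p])) * bmaxPlusToBdR F p x := by
  haveI : IsDomain (BDeRhamPlus (integerC F) p) := isDomain_bDeRhamPlus hF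
  have hφx := frobBmaxPlus_eq_pi_mul_of_honda_of_hodgePair hF hpv hαπ hu hφu hx ρ hρ hfil hne
  have hπ' : embBdRHom hpv hF (LocalField.padicRingHom F p hpv (π : ℚ_[p])) = bmaxPlusToBdR F p (ainfToBmaxPlus F p (zpToAinf π)) := by
    rw [AinfRam.embBdRHom_padicRingHom' (hp := hpv) hF, bmaxPlusToBdR_ainfToBmaxPlus_zpToAinf]
  have hH : embBdRHom hpv hF A * bmaxPlusToBdR F p x + embBdRHom hpv hF B * bmaxPlusToBdR F p (frobBmaxPlus F p x) =
      embBdRHom hpv hF (A + B * LocalField.padicRingHom F p hpv (π : ℚ_[p])) * bmaxPlusToBdR F p x := by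
    rw [hφx, map_mul, ← hπ', map_add, map_mul]; ring
  have hγ : A + B * LocalField.padicRingHom F p hpv (π : ℚ_[p]) ≠ 0 := fun h => hne (by rw [hH, h, map_zero, zero_mul])
  refine ⟨?_, hγ, hH⟩
  have h1 := hfil
  rw [hH, map_mul, thetaBdR_embBdRHom, mul_eq_zero, map_eq_zero_iff _ (algebraMap F (CompletedAlgClosure F)).injective,
    thetaBdR_bmaxPlusToBdR] at h1
  have h2 := h1.resolve_left hγ
  exact_mod_cast h2

/-! ## §3 Fontaine's lemma: `p^k·u·x = c·t`, and `u` is a `χρ⁻¹`-period -/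

set_option maxHeartbeats 3200000 in
set_option synthInstance.maxHeartbeats 400000 in
/-- ★★ **`p^k · u·x = ι(c)·t` with `c ≠ 0`.** In the situation of `frobBmaxPlus_eq_pi_mul_of_honda_of_hodgePair`, `ux ∈ (A_max)^{φ=p} ∩ ker θ`
(`φ(ux) = αu·πx = p·ux`, `θ(x) = 0`), so Fontaine's lemma (`fontaineKernel'`) gives `p^k·ux = ι(c)·t`; `c ≠ 0` because `x ≠ 0` (`H₀ ≠ 0`) and `p`, `u`
are non-zero-divisors. [cite: FontaineAsterisque223III, Exp. III Th. 5.3.7] [cite: Colmez1998Annals, §III.3] -/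
theorem exists_pow_mul_unitRoot_mul_eq_tBmax (hF : Function.Surjective (fontaineTheta (integerC F) p)) (hpv : valuation F p < 1)
    {α π : ℤ_[p]} (hαπ : α * π = p) {u : BmaxPlus F p} (hu : IsUnit u)
    (hφu : frobBmaxPlus F p u = ainfToBmaxPlus F p (zpToAinf α) * u) {x : BmaxPlus F p}
    (hx : frobBmaxPlus F p (frobBmaxPlus F p x) - ainfToBmaxPlus F p (zpToAinf (α + π)) * frobBmaxPlus F p x + (p : BmaxPlus F p) * x = 0)
    (ρ : absoluteGaloisGroup F → ℤ_[p]) (hρ : ∀ σ, galBmaxPlus σ x = ainfToBmaxPlus F p (zpToAinf (ρ σ)) * x)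
    {A B : F} (hfil : thetaBdR (embBdRHom hpv hF A * bmaxPlusToBdR F p x + embBdRHom hpv hF B * bmaxPlusToBdR F p (frobBmaxPlus F p x)) = 0)
    (hne : embBdRHom hpv hF A * bmaxPlusToBdR F p x + embBdRHom hpv hF B * bmaxPlusToBdR F p (frobBmaxPlus F p x) ≠ 0) :
    ∃ (k : ℕ) (c : ℤ_[p]), c ≠ 0 ∧ (p : BmaxPlus F p) ^ k * (u * x) = ainfToBmaxPlus F p (zpToAinf c) * tBmax := by
  have hφx := frobBmaxPlus_eq_pi_mul_of_honda_of_hodgePair hF hpv hαπ hu hφu hx ρ hρ hfil hne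
  obtain ⟨hθx, -, -⟩ := thetaBmaxPlus_eq_zero_of_honda_of_hodgePair hF hpv hαπ hu hφu hx ρ hρ hfil hne
  have hφux : frobBmaxPlus F p (u * x) = (p : BmaxPlus F p) * (u * x) := by
    have hp' : (p : BmaxPlus F p) = ainfToBmaxPlus F p (zpToAinf α) * ainfToBmaxPlus F p (zpToAinf π) := by
      rw [← map_mul, ← map_mul, hαπ, map_natCast, map_natCast]
    rw [map_mul, hφu, hφx, hp']; ring
  have hθux : thetaBmaxPlus F p (u * x) = 0 := by rw [map_mul, hθx, mul_zero]
  obtain ⟨k, c, hkc⟩ := fontaineKernel' hF hφux hθux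
  refine ⟨k, c, fun hc0 => hne ?_, hkc⟩
  rw [hc0, map_zero, map_zero, zero_mul] at hkc
  have hux : u * x = 0 := eq_zero_of_natCast_pow_mul_eq_zero hF k hkc
  have hx0 : x = 0 := by simpa [hu.mul_right_eq_zero] using hux
  rw [hx0, map_zero, map_zero, map_zero, mul_zero, mul_zero, add_zero]

set_option maxHeartbeats 3200000 in
set_option synthInstance.maxHeartbeats 400000 in
/-- ★★ **`u` is a `ψ = χρ⁻¹`-period: `ρ(σ)·σ(u) = χ(σ)·u`** for every `σ ∈ Γ_F` (`χ` the cyclotomic character). Apply `σ` to `p^k·ux = c·t`: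
`σx = ρ(σ)x`, `σt = χ(σ)t`; cancel the non-zero-divisors `t` and `ι(c)`. So the Galois character of the unit-root period is FORCED by the formal
line: no reduction theory of the étale quotient is needed. [cite: Tate1967, §4] [cite: FontaineAsterisque223III, Exp. III Th. 5.3.7] -/
theorem galBmaxPlus_unitRoot_mul (hF : Function.Surjective (fontaineTheta (integerC F) p)) (hpv : valuation F p < 1)
    {α π : ℤ_[p]} (hαπ : α * π = p) {u : BmaxPlus F p} (hu : IsUnit u)
    (hφu : frobBmaxPlus F p u = ainfToBmaxPlus F p (zpToAinf α) * u) {x : BmaxPlus F p}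
    (hx : frobBmaxPlus F p (frobBmaxPlus F p x) - ainfToBmaxPlus F p (zpToAinf (α + π)) * frobBmaxPlus F p x + (p : BmaxPlus F p) * x = 0)
    (ρ : absoluteGaloisGroup F → ℤ_[p]) (hρ : ∀ σ, galBmaxPlus σ x = ainfToBmaxPlus F p (zpToAinf (ρ σ)) * x)
    {A B : F} (hfil : thetaBdR (embBdRHom hpv hF A * bmaxPlusToBdR F p x + embBdRHom hpv hF B * bmaxPlusToBdR F p (frobBmaxPlus F p x)) = 0)
    (hne : embBdRHom hpv hF A * bmaxPlusToBdR F p x + embBdRHom hpv hF B * bmaxPlusToBdR F p (frobBmaxPlus F p x) ≠ 0)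
    (σ : absoluteGaloisGroup F) :
    ainfToBmaxPlus F p (zpToAinf (ρ σ)) * galBmaxPlus σ u =
      ainfToBmaxPlus F p (zpToAinf ((GaloisRep.cyclotomicCharacter F p σ : ℤ_[p]ˣ) : ℤ_[p])) * u := by
  obtain ⟨k, c, hc0, hkc⟩ := exists_pow_mul_unitRoot_mul_eq_tBmax hF hpv hαπ hu hφu hx ρ hρ hfil hne
  obtain ⟨r, hr⟩ : ∃ r, r = ainfToBmaxPlus F p (zpToAinf (ρ σ)) := ⟨_, rfl⟩
  obtain ⟨χ', hχ⟩ : ∃ y, y = ainfToBmaxPlus F p (zpToAinf ((GaloisRep.cyclotomicCharacter F p σ : ℤ_[p]ˣ) : ℤ_[p])) := ⟨_, rfl⟩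
  obtain ⟨ic, hic⟩ : ∃ y, y = ainfToBmaxPlus F p (zpToAinf c) := ⟨_, rfl⟩
  -- apply `σ` to `p^k·u·x = ι(c)·t`
  have E : (p : BmaxPlus F p) ^ k * (galBmaxPlus σ u * (r * x)) = ic * (χ' * tBmax) := by
    have h := congrArg (galBmaxPlus σ) hkc
    rwa [map_mul, map_pow, map_natCast, map_mul, hρ, map_mul, galBmaxPlus_ainfToBmaxPlus, galAinf_zpToAinf, galBmaxPlus_tBmax,
      ← hr, ← hχ, ← hic] at h
  rw [← hic] at hkc
  rw [← hr, ← hχ]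
  -- `t · (ι(c) · (χ u − ρ σu)) = 0`
  have key : tBmax * (ic * (χ' * u - r * galBmaxPlus σ u)) = 0 := by
    linear_combination (r * galBmaxPlus σ u) * hkc + (-u) * E
  have h2 : ic * (χ' * u - r * galBmaxPlus σ u) = 0 := eq_zero_of_tBmax_mul_eq_zero hF key
  have h3 : χ' * u - r * galBmaxPlus σ u = 0 := eq_zero_of_zpToAinf_mul_eq_zero hF hc0 (hic ▸ h2)
  linear_combination (-1 : BmaxPlus F p) * h3

/-! ## §4 The Kummer integral: `φΛ = πΛ` -/

set_option maxHeartbeats 3200000 in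
set_option synthInstance.maxHeartbeats 400000 in
/-- ★★ **`φΛ = πΛ` for the Kummer integral.** In the situation of `frobBmaxPlus_eq_pi_mul_of_honda_of_hodgePair`, let `Λ ∈ A_max` satisfy the
same Honda relation and `σΛ = Λ + ι(k σ)·x` (`σ ∈ Γ_F`), and suppose `ρ ≠ χ` (some `σ₁` with `ρ(σ₁) ≠ χ(σ₁)`). Then **`φΛ = ι(π)·Λ`**: `φΛ − πΛ = c″u`
(§1) is `Γ_F`-invariant (`φx = πx`), while `ρ(σ₁)σ₁u = χ(σ₁)u` — so `(χ(σ₁) − ρ(σ₁))·c″u = 0`.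
[cite: Kato1993LNM1553, Ch. II Lemma 1.4.3] [cite: BlochKato1990, Example 3.11] [cite: Colmez1998Annals, §III.2] -/
theorem frobBmaxPlus_kummer_eq_pi_mul (hF : Function.Surjective (fontaineTheta (integerC F) p)) (hpv : valuation F p < 1)
    {α π : ℤ_[p]} (hαπ : α * π = p) {u : BmaxPlus F p} (hu : IsUnit u)
    (hφu : frobBmaxPlus F p u = ainfToBmaxPlus F p (zpToAinf α) * u) {x : BmaxPlus F p}
    (hx : frobBmaxPlus F p (frobBmaxPlus F p x) - ainfToBmaxPlus F p (zpToAinf (α + π)) * frobBmaxPlus F p x + (p : BmaxPlus F p) * x = 0)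
    (ρ : absoluteGaloisGroup F → ℤ_[p]) (hρ : ∀ σ, galBmaxPlus σ x = ainfToBmaxPlus F p (zpToAinf (ρ σ)) * x)
    {A B : F} (hfil : thetaBdR (embBdRHom hpv hF A * bmaxPlusToBdR F p x + embBdRHom hpv hF B * bmaxPlusToBdR F p (frobBmaxPlus F p x)) = 0)
    (hne : embBdRHom hpv hF A * bmaxPlusToBdR F p x + embBdRHom hpv hF B * bmaxPlusToBdR F p (frobBmaxPlus F p x) ≠ 0)
    (hρχ : ∃ σ₁, ρ σ₁ ≠ ((GaloisRep.cyclotomicCharacter F p σ₁ : ℤ_[p]ˣ) : ℤ_[p]))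
    {Λ : BmaxPlus F p}
    (hΛ : frobBmaxPlus F p (frobBmaxPlus F p Λ) - ainfToBmaxPlus F p (zpToAinf (α + π)) * frobBmaxPlus F p Λ + (p : BmaxPlus F p) * Λ = 0)
    (kum : absoluteGaloisGroup F → ℤ_[p]) (hgalΛ : ∀ σ, galBmaxPlus σ Λ = Λ + ainfToBmaxPlus F p (zpToAinf (kum σ)) * x) :
    frobBmaxPlus F p Λ = ainfToBmaxPlus F p (zpToAinf π) * Λ := by
  have hφx := frobBmaxPlus_eq_pi_mul_of_honda_of_hodgePair hF hpv hαπ hu hφu hx ρ hρ hfil hne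
  obtain ⟨c'', hc''⟩ := exists_eq_zp_mul_unitRoot_of_frobBmaxPlus_eq hF hu hφu (frobBmaxPlus_sub_pi_mul_of_honda hαπ hΛ)
  obtain ⟨σ₁, hσ₁⟩ := hρχ
  obtain ⟨b, hb⟩ : ∃ b, b = ainfToBmaxPlus F p (zpToAinf π) := ⟨_, rfl⟩
  obtain ⟨r'', hr''⟩ : ∃ r, r = ainfToBmaxPlus F p (zpToAinf c'') := ⟨_, rfl⟩
  rw [← hb] at hφx
  rw [← hb, ← hr''] at hc''
  -- `Γ_F`-invariance of `φΛ − πΛ`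
  have hinv : ∀ σ, r'' * galBmaxPlus σ u = r'' * u := by
    intro σ
    obtain ⟨q, hq⟩ : ∃ q, q = ainfToBmaxPlus F p (zpToAinf (kum σ)) := ⟨_, rfl⟩
    have hσb : galBmaxPlus σ b = b := by rw [hb, galBmaxPlus_ainfToBmaxPlus, galAinf_zpToAinf]
    have hσr : galBmaxPlus σ r'' = r'' := by rw [hr'', galBmaxPlus_ainfToBmaxPlus, galAinf_zpToAinf]
    have hφq : frobBmaxPlus F p q = q := by rw [hq, frobBmaxPlus_ainfToBmaxPlus, frobenius_zpToAinf]
    have h := congrArg (galBmaxPlus σ) hc''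
    rw [map_sub, map_mul, galBmaxPlus_frobBmaxPlus, hgalΛ, map_add, map_mul, ← hq, hφq, hφx, hσb, map_mul, hσr] at h
    -- h : φΛ + q * (b * x) - b * (Λ + q * x) = r'' * σu
    linear_combination hc'' - h
  -- at `σ₁`: `ρ σ₁u = χ u`
  have hper := galBmaxPlus_unitRoot_mul hF hpv hαπ hu hφu hx ρ hρ hfil hne σ₁
  obtain ⟨r₁, hr₁⟩ : ∃ r, r = ainfToBmaxPlus F p (zpToAinf (ρ σ₁)) := ⟨_, rfl⟩
  obtain ⟨χ₁, hχ₁⟩ : ∃ y, y = ainfToBmaxPlus F p (zpToAinf ((GaloisRep.cyclotomicCharacter F p σ₁ : ℤ_[p]ˣ) : ℤ_[p])) := ⟨_, rfl⟩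
  rw [← hr₁, ← hχ₁] at hper
  have h1 := hinv σ₁
  have key : ainfToBmaxPlus F p (zpToAinf (((GaloisRep.cyclotomicCharacter F p σ₁ : ℤ_[p]ˣ) : ℤ_[p]) - ρ σ₁)) * (r'' * u) = 0 := by
    rw [map_sub, map_sub, ← hr₁, ← hχ₁]
    linear_combination (-r'') * hper + r₁ * h1
  have h2 : r'' * u = 0 := eq_zero_of_zpToAinf_mul_eq_zero hF (sub_ne_zero.2 (Ne.symm hσ₁)) key
  rw [h2, sub_eq_zero] at hc''
  rw [← hb, hc'']

end Literature.NumberTheory.PAdicHodge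

end
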